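import Mathlib.Analysis.SpecificLimits.Normed
import Mathlib.Topology.Order.LiminfLimsup

/-!
# Beta / EriceFlowEnclosureAbelMeanSeq — THE EXPONENTIALLY WEIGHTED (ABEL) CUTOFF AVERAGE OF A SEQUENCE, ABELIAN SIDE:
# `a n → m ⟹ (1 − x)·Σ a n xⁿ → m` AND THE INCLUSION `n⁻¹·Σ_{i<n} a i → m ⟹ (1 − x)·Σ a n xⁿ → m` (x → 1⁻)
# (pure [folklore] SERVICE for the BARE ∕ CUTOFF side of rows L131–L142; Mathlib only; the Tauberian converse is P2 #54b).
# For a real sequence a : ℕ → ℝ, its ABEL MEAN is `(1 − x)·Σ' n, a n·xⁿ` (the exponential weights `(1 − x)xⁿ` sum to 1), x → 1⁻: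
#   §1 SERVICE — summability against the geometric series (bounded ∕ linearly growing a), the weights `(1 − x)·Σ xⁿ = 1` and
#      `(1 − x)²·Σ (n+1)xⁿ = 1`, and ONE KERNEL ESTIMATE `|Σ' v n·c n| ≤ Σ_{n<N} v n·|c n| + η·Σ' v n` for nonnegative summable weights v,
#      c bounded with `|c n| ≤ η` beyond N (`weighted_tsum_abs_le`);
#   §2 ABELIAN — **`abel_of_tendsto`** (`a n → m ⟹ Abel → m`) and the INCLUSION **`abel_of_cesaro`** (`n⁻¹·Σ_{i<n} a i → m ⟹ Abel → m`, through
#      `Σ a n xⁿ = (1 − x)·Σ A_{n+1} xⁿ`, `A_k = Σ_{i<k} a i`, i.e. `(1 − x)Σ a n xⁿ = (1 − x)²Σ (n+1)σ_{n+1} xⁿ` — the Abel mean is a positive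
#      mass-one average OF the Cesàro means whose mass on every initial segment vanishes as x → 1⁻).
# (β-flow team, prover 2 = lower ∕ positivity side, unit `b2b-balaban-beta-bflow-p2`, gen 37; module P2 #54a; no Erice sentence occurs)

HONEST FRAMING (page 1 of everything the β sub-cell writes): discharging `BetaPertH` makes Bałaban's UV stability UNCONDITIONAL — a
real constructive-QFT result; it is NOT the continuum limit and NOT the Clay problem.  HONEST DEPENDENCY (cell reorg 2026-08-19,
verbatim): «continuum YM on T⁴ ⇐ BetaPertH ∧ nine spine estimates (0/9 proved); BetaPertH ⇐ (D1) ∧ (D4) ∧ CAP+tail; G-an2-4 gates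
asym, D1 and NE2/3/4.»  THIS MODULE DISCHARGES NOTHING and quotes nothing: [folklore] real analysis about real sequences (N. H. Abel 1826;
Hardy, Divergent Series (1949) §1.4 and Thm 55 «(C,k) ⟹ Abel»).  Mathlib has Abel's limit theorem for SERIES
(`Real.tendsto_tsum_powerSeries_nhdsWithin_lt`); the sequence ∕ Cesàro forms here are proved directly from one kernel estimate.

THE POINT.  `(1 − x)·Σ a n xⁿ − m = Σ (1 − x)xⁿ·(a n − m)` is an average with positive weights of total mass 1 whose mass on every fixed
initial segment n < N is `≤ N(1 − x) → 0` — so it inherits limits; and `Σ a n xⁿ = (1 − x)Σ A_{n+1}xⁿ` (Abel summation, `A_0 = 0`) makes the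
Abel mean the average `(1 − x)²Σ (n+1)xⁿ·σ_{n+1}` of the Cesàro means with the same two properties (head mass `≤ N²(1 − x)²`).

WHAT THIS FILE PROVES (0 sorry, 0 def): §1 `exists_abs_le_of_tendsto`, `summable_mul_pow_of_abs_le`, `summable_mul_pow_of_abs_le_linear`,
`one_sub_mul_tsum_pow`, `tsum_succ_mul_pow`, `one_sub_sq_mul_tsum_succ_mul_pow`, **`weighted_tsum_abs_le`**; §2 `abel_sub_eq`, **`abel_of_tendsto`**,
`abel_const_of_null`, `tsum_mul_pow_eq_one_sub_mul_tsum_partial`, `abel_eq_sq_mul_tsum_partial`, **`abel_of_cesaro`**, `summable_mul_pow_of_cesaro`.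
NOT CLAIMED: the Tauberian converses (P2 #54b: Hardy–Littlewood–Karamata by name); other weights (P2 #54c ∕ #54d); anything about β-functions
(the consumer instantiates a = the sampled datum ∕ the 1∕K letter deviation along the bare couplings, P2 #54e); `BetaPertH`; continuum; Clay.
-/

namespace Summit.QuantumFields.BalabanUV.Beta.EriceFlowEnclosureAbelMeanSeq

open Finset Filter Topology

noncomputable section

variable {a : ℕ → ℝ}

/-! ## §1 Service: summability, the Abel weights, one kernel estimate -/

/-- A convergent real sequence is bounded: `∃ B, ∀ n, |a n| ≤ B`. [folklore] -/
theorem exists_abs_le_of_tendsto {m : ℝ} (ha : Tendsto a atTop (𝓝 m)) : ∃ B, ∀ n, |a n| ≤ B := by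
  obtain ⟨B, hB⟩ := ha.abs.bddAbove_range
  exact ⟨B, fun n => hB ⟨n, rfl⟩⟩

/-- A bounded sequence against the geometric series: `Σ a n xⁿ` converges absolutely for `0 ≤ x < 1`. [folklore] -/
theorem summable_mul_pow_of_abs_le {B x : ℝ} (hB : ∀ n, |a n| ≤ B) (hx0 : 0 ≤ x) (hx1 : x < 1) :
    Summable fun n => a n * x ^ n := by
  refine Summable.of_norm_bounded ((summable_geometric_of_lt_one hx0 hx1).mul_left B) fun n => ?_
  rw [Real.norm_eq_abs, abs_mul, abs_of_nonneg (pow_nonneg hx0 n)]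
  exact mul_le_mul_of_nonneg_right (hB n) (pow_nonneg hx0 n)

/-- A sequence of at most linear growth against the geometric series: `|a n| ≤ B·(n + 1)` ⟹ `Σ a n xⁿ` converges absolutely for
`0 ≤ x < 1`. [folklore] -/
theorem summable_mul_pow_of_abs_le_linear {B x : ℝ} (hB : ∀ n, |a n| ≤ B * (n + 1)) (hx0 : 0 ≤ x) (hx1 : x < 1) :
    Summable fun n => a n * x ^ n := by
  have hx : ‖x‖ < 1 := by rwa [Real.norm_eq_abs, abs_of_nonneg hx0]
  have h1 : Summable fun n : ℕ => (n : ℝ) ^ 1 * x ^ n := summable_pow_mul_geometric_of_norm_lt_one 1 hx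
  have h2 : Summable fun n : ℕ => B * ((n : ℝ) ^ 1 * x ^ n) + B * x ^ n :=
    (h1.mul_left B).add ((summable_geometric_of_lt_one hx0 hx1).mul_left B)
  refine Summable.of_norm_bounded h2 fun n => ?_
  rw [Real.norm_eq_abs, abs_mul, abs_of_nonneg (pow_nonneg hx0 n), pow_one]
  have := mul_le_mul_of_nonneg_right (hB n) (pow_nonneg hx0 n)
  linarith

/-- THE ABEL WEIGHTS HAVE MASS ONE: `(1 − x)·Σ' xⁿ = 1` for `0 ≤ x < 1`. [folklore] -/
theorem one_sub_mul_tsum_pow {x : ℝ} (hx0 : 0 ≤ x) (hx1 : x < 1) : (1 - x) * ∑' n : ℕ, x ^ n = 1 := by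
  rw [tsum_geometric_of_lt_one hx0 hx1, mul_inv_cancel₀ (sub_pos.mpr hx1).ne']

/-- `Σ' (n + 1)·xⁿ = ((1 − x)²)⁻¹` for `0 ≤ x < 1` (Mathlib's `Σ n·xⁿ = x∕(1 − x)²` plus the geometric series). [folklore] -/
theorem tsum_succ_mul_pow {x : ℝ} (hx0 : 0 ≤ x) (hx1 : x < 1) :
    (Summable fun n : ℕ => ((n : ℝ) + 1) * x ^ n) ∧ ∑' n : ℕ, ((n : ℝ) + 1) * x ^ n = ((1 - x) ^ 2)⁻¹ := by
  have hx : ‖x‖ < 1 := by rwa [Real.norm_eq_abs, abs_of_nonneg hx0]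
  have h1 := hasSum_coe_mul_geometric_of_norm_lt_one hx
  have h2 := hasSum_geometric_of_lt_one hx0 hx1
  have hfg : (fun n : ℕ => ((n : ℝ) + 1) * x ^ n) = fun n : ℕ => (n : ℝ) * x ^ n + x ^ n := by
    funext n; ring
  have h3 : HasSum (fun n : ℕ => ((n : ℝ) + 1) * x ^ n) (x / (1 - x) ^ 2 + (1 - x)⁻¹) := by
    rw [hfg]; exact h1.add h2
  have h1x : (1 - x) ≠ 0 := (sub_pos.mpr hx1).ne'
  have hval : x / (1 - x) ^ 2 + (1 - x)⁻¹ = ((1 - x) ^ 2)⁻¹ := by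
    field_simp
    ring
  exact ⟨h3.summable, by rw [h3.tsum_eq, hval]⟩

/-- THE SECOND-ORDER ABEL WEIGHTS HAVE MASS ONE: `(1 − x)²·Σ' (n + 1)xⁿ = 1` for `0 ≤ x < 1`. [folklore] -/
theorem one_sub_sq_mul_tsum_succ_mul_pow {x : ℝ} (hx0 : 0 ≤ x) (hx1 : x < 1) :
    (1 - x) ^ 2 * ∑' n : ℕ, ((n : ℝ) + 1) * x ^ n = 1 := by
  rw [(tsum_succ_mul_pow hx0 hx1).2, mul_inv_cancel₀ (pow_ne_zero 2 (sub_pos.mpr hx1).ne')]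

/-- **ONE KERNEL ESTIMATE.**  Nonnegative summable weights v, a bounded sequence c (`|c n| ≤ C`) with `|c n| ≤ η` for `n ≥ N` ⟹
`|Σ' v n·c n| ≤ Σ_{n<N} v n·|c n| + η·Σ' v n`: the head is finite, the tail is η times the total mass. [folklore] -/
theorem weighted_tsum_abs_le {v c : ℕ → ℝ} (hv : ∀ n, 0 ≤ v n) (hvs : Summable v) {C : ℝ} (hC : ∀ n, |c n| ≤ C)
    {η : ℝ} (hη : 0 ≤ η) {N : ℕ} (hN : ∀ n, N ≤ n → |c n| ≤ η) :
    |∑' n, v n * c n| ≤ (∑ n ∈ range N, v n * |c n|) + η * ∑' n, v n := by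
  have hs : Summable fun n => v n * c n := by
    refine Summable.of_norm_bounded (hvs.mul_left C) fun n => ?_
    rw [Real.norm_eq_abs, abs_mul, abs_of_nonneg (hv n), mul_comm C]
    exact mul_le_mul_of_nonneg_left (hC n) (hv n)
  have hsplit := hs.sum_add_tsum_nat_add N
  have htail_s : Summable fun n => v (n + N) * c (n + N) := (summable_nat_add_iff N).mpr hs
  have hv_s : Summable fun n => v (n + N) := (summable_nat_add_iff N).mpr hvs
  -- the tail
  have htail : |∑' n, v (n + N) * c (n + N)| ≤ η * ∑' n, v n := by
    have hup : ∑' n, v (n + N) * c (n + N) ≤ ∑' n, η * v (n + N) := by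
      refine htail_s.tsum_le_tsum (fun n => ?_) (hv_s.mul_left η)
      have h := (abs_le.mp (hN (n + N) (Nat.le_add_left N n))).2
      calc v (n + N) * c (n + N) ≤ v (n + N) * η := mul_le_mul_of_nonneg_left h (hv _)
        _ = η * v (n + N) := mul_comm _ _
    have hlo : ∑' n, -(η * v (n + N)) ≤ ∑' n, v (n + N) * c (n + N) := by
      refine Summable.tsum_le_tsum (fun n => ?_) (hv_s.mul_left η).neg htail_s
      have h := (abs_le.mp (hN (n + N) (Nat.le_add_left N n))).1
      have : v (n + N) * -η ≤ v (n + N) * c (n + N) := mul_le_mul_of_nonneg_left h (hv _)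
      linarith
    rw [tsum_neg, tsum_mul_left] at hlo
    rw [tsum_mul_left] at hup
    have hshift : ∑' n, v (n + N) ≤ ∑' n, v n := by
      rw [← hvs.sum_add_tsum_nat_add N]
      have : 0 ≤ ∑ n ∈ range N, v n := sum_nonneg fun n _ => hv n
      linarith
    have h1 : η * ∑' n, v (n + N) ≤ η * ∑' n, v n := mul_le_mul_of_nonneg_left hshift hη
    exact abs_le.mpr ⟨by linarith, by linarith⟩
  -- the head
  have hhead : |∑ n ∈ range N, v n * c n| ≤ ∑ n ∈ range N, v n * |c n| := by
    refine (abs_sum_le_sum_abs _ _).trans (le_of_eq (sum_congr rfl fun n _ => ?_))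
    rw [abs_mul, abs_of_nonneg (hv n)]
  rw [← hsplit]
  exact (abs_add_le _ _).trans (add_le_add hhead htail)

/-! ## §2 The Abelian direction: limits and Cesàro limits pass to the Abel mean -/

/-- The centred Abel mean: for `0 ≤ x < 1` and `Σ a n xⁿ` summable, `(1 − x)·Σ' a n xⁿ − m = Σ' ((1 − x)xⁿ)·(a n − m)`. [folklore] -/
theorem abel_sub_eq {x : ℝ} (hx0 : 0 ≤ x) (hx1 : x < 1) (hs : Summable fun n => a n * x ^ n) (m : ℝ) :
    (1 - x) * ∑' n, a n * x ^ n - m = ∑' n, ((1 - x) * x ^ n) * (a n - m) := by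
  have hg : Summable fun n : ℕ => m * x ^ n := (summable_geometric_of_lt_one hx0 hx1).mul_left m
  have h1 : ∑' n, ((1 - x) * x ^ n) * (a n - m) = (1 - x) * ∑' n, (a n * x ^ n - m * x ^ n) := by
    rw [← tsum_mul_left]; exact tsum_congr fun n => by ring
  rw [h1, hs.tsum_sub hg, tsum_mul_left, mul_sub, ← mul_assoc, mul_comm (1 - x) m, mul_assoc,
    one_sub_mul_tsum_pow hx0 hx1, mul_one]

/-- **THE ABELIAN THEOREM**: `a n → m ⟹ (1 − x)·Σ' a n xⁿ → m` as x → 1⁻ (for x ≥ 0 the series converges since a is bounded).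
[folklore] (N. H. Abel 1826; Hardy, Divergent Series Thm 55 for sequences) -/
theorem abel_of_tendsto {m : ℝ} (ha : Tendsto a atTop (𝓝 m)) :
    Tendsto (fun x : ℝ => (1 - x) * ∑' n, a n * x ^ n) (𝓝[<] 1) (𝓝 m) := by
  obtain ⟨B, hB⟩ := exists_abs_le_of_tendsto ha
  have hB0 : 0 ≤ B := (abs_nonneg _).trans (hB 0)
  have hc : ∀ n, |a n - m| ≤ B + |m| := fun n => by
    have h1 := abs_sub (a n) m; have h2 := hB n; linarith
  rw [Metric.tendsto_nhds]
  intro ε hε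
  obtain ⟨N, hN⟩ := Metric.tendsto_atTop.mp ha (ε / 2) (by linarith)
  -- threshold: (1 − x)·N·(B + |m|) ≤ ε∕4
  set D : ℝ := (N : ℝ) * (B + |m|) + 1 with hD
  have hD0 : 0 < D := by positivity
  set x₀ : ℝ := max (1 / 2) (1 - ε / (4 * D)) with hx₀
  have hx₀1 : x₀ < 1 := max_lt (by norm_num) (by linarith [show 0 < ε / (4 * D) from by positivity])
  filter_upwards [Ioo_mem_nhdsLT hx₀1] with x hx
  obtain ⟨hx₀x, hx1⟩ := hx
  have hx0 : 0 ≤ x := le_trans (le_trans (by norm_num) (le_max_left _ _)) hx₀x.le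
  have h1x : 0 < 1 - x := sub_pos.mpr hx1
  have h1x' : 1 - x ≤ ε / (4 * D) := by have := le_max_right (1 / 2 : ℝ) (1 - ε / (4 * D)); linarith
  have hs : Summable fun n => a n * x ^ n := summable_mul_pow_of_abs_le hB hx0 hx1
  rw [Real.dist_eq, abel_sub_eq hx0 hx1 hs m]
  -- the kernel estimate with v n = (1 − x)xⁿ, c n = a n − m, η = ε∕2
  have hv : ∀ n, 0 ≤ (1 - x) * x ^ n := fun n => mul_nonneg h1x.le (pow_nonneg hx0 n)
  have hvs : Summable fun n => (1 - x) * x ^ n := (summable_geometric_of_lt_one hx0 hx1).mul_left _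
  have hη : ∀ n, N ≤ n → |a n - m| ≤ ε / 2 := fun n hn => by
    have := hN n hn; rw [Real.dist_eq] at this; exact this.le
  have hest := weighted_tsum_abs_le hv hvs hc (by linarith) hη
  have hmass : ∑' n, (1 - x) * x ^ n = 1 := by rw [tsum_mul_left, one_sub_mul_tsum_pow hx0 hx1]
  rw [hmass, mul_one] at hest
  -- the head: each weight ≤ (1 − x), each |c| ≤ B + |m|
  have hhead : ∑ n ∈ range N, (1 - x) * x ^ n * |a n - m| ≤ (N : ℝ) * ((1 - x) * (B + |m|)) := by
    have hterm : ∀ n ∈ range N, (1 - x) * x ^ n * |a n - m| ≤ (1 - x) * (B + |m|) := by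
      intro n _
      have hxn : x ^ n ≤ 1 := pow_le_one₀ hx0 hx1.le
      calc (1 - x) * x ^ n * |a n - m| ≤ (1 - x) * 1 * (B + |m|) :=
            mul_le_mul (mul_le_mul_of_nonneg_left hxn h1x.le) (hc n) (abs_nonneg _) (by positivity)
        _ = (1 - x) * (B + |m|) := by ring
    have := sum_le_sum hterm
    rwa [sum_const, card_range, nsmul_eq_mul] at this
  have hhead' : (N : ℝ) * ((1 - x) * (B + |m|)) ≤ ε / 4 := by
    have h2 : (N : ℝ) * (B + |m|) ≤ D := by rw [hD]; linarith
    calc (N : ℝ) * ((1 - x) * (B + |m|)) = (1 - x) * ((N : ℝ) * (B + |m|)) := by ring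
      _ ≤ ε / (4 * D) * D := mul_le_mul h1x' h2 (by positivity) (by positivity)
      _ = ε / 4 := by field_simp
  linarith

/-- THE ABEL MEAN OF A NULL SEQUENCE TIMES CONSTANTS: `e n → 0 ⟹ (1 − x)·Σ' e n xⁿ → 0` (a named instance of `abel_of_tendsto`). [folklore] -/
theorem abel_const_of_null {e : ℕ → ℝ} (he : Tendsto e atTop (𝓝 0)) :
    Tendsto (fun x : ℝ => (1 - x) * ∑' n, e n * x ^ n) (𝓝[<] 1) (𝓝 0) :=
  abel_of_tendsto he

/-- ABEL SUMMATION AGAINST THE GEOMETRIC SERIES: with the partial sums `A k = Σ_{i<k} a i`, if `Σ A_{n+1} xⁿ` is summable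
(`0 ≤ x < 1`) then `Σ a n xⁿ` is summable and **`Σ' a n xⁿ = (1 − x)·Σ' A_{n+1} xⁿ`** (`A_{n+1} − A_n = a n`, `A_0 = 0`). [folklore] -/
theorem tsum_mul_pow_eq_one_sub_mul_tsum_partial {x : ℝ}
    (hA : Summable fun n : ℕ => (∑ i ∈ range (n + 1), a i) * x ^ n) :
    (Summable fun n => a n * x ^ n) ∧
      ∑' n, a n * x ^ n = (1 - x) * ∑' n : ℕ, (∑ i ∈ range (n + 1), a i) * x ^ n := by
  -- the shifted series Σ A_n xⁿ is summable too (its first term vanishes)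
  set F : ℕ → ℝ := fun n => (∑ i ∈ range n, a i) * x ^ n with hF
  have hF1 : Summable fun n => F (n + 1) := by
    have : (fun n => F (n + 1)) = fun n => x * ((∑ i ∈ range (n + 1), a i) * x ^ n) := by
      funext n; simp only [hF, pow_succ]; ring
    rw [this]; exact hA.mul_left x
  have hFs : Summable F := (summable_nat_add_iff 1).mp hF1
  have hF0 : F 0 = 0 := by simp [hF]
  have hshift : ∑' n, F (n + 1) = ∑' n, F n := by
    rw [hFs.tsum_eq_zero_add, hF0, zero_add]
  -- a n xⁿ = A_{n+1} xⁿ − A_n xⁿ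
  have hdiff : ∀ n, a n * x ^ n = (∑ i ∈ range (n + 1), a i) * x ^ n - F n := by
    intro n; simp only [hF, sum_range_succ]; ring
  have hsum : Summable fun n => a n * x ^ n := by
    have := hA.sub hFs
    exact this.congr fun n => (hdiff n).symm
  refine ⟨hsum, ?_⟩
  calc ∑' n, a n * x ^ n = ∑' n, ((∑ i ∈ range (n + 1), a i) * x ^ n - F n) := tsum_congr hdiff
    _ = ∑' n, (∑ i ∈ range (n + 1), a i) * x ^ n - ∑' n, F n := hA.tsum_sub hFs
    _ = ∑' n, (∑ i ∈ range (n + 1), a i) * x ^ n - ∑' n, F (n + 1) := by rw [hshift]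
    _ = ∑' n, (∑ i ∈ range (n + 1), a i) * x ^ n - x * ∑' n, (∑ i ∈ range (n + 1), a i) * x ^ n := by
        congr 1
        rw [← tsum_mul_left]
        exact tsum_congr fun n => by simp only [hF, pow_succ]; ring
    _ = (1 - x) * ∑' n : ℕ, (∑ i ∈ range (n + 1), a i) * x ^ n := by ring

/-- THE ABEL MEAN IS A SECOND-ORDER AVERAGE OF THE CESÀRO MEANS: if the Cesàro means are bounded, `|k⁻¹·A k| ≤ B'` for all k, then for
`0 ≤ x < 1`: `Σ a n xⁿ` is summable and **`(1 − x)·Σ' a n xⁿ = (1 − x)²·Σ' ((n+1)·σ_{n+1}) xⁿ`** with `(n+1)·σ_{n+1} = A_{n+1}`. [folklore] -/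
theorem abel_eq_sq_mul_tsum_partial {x B' : ℝ} (hx0 : 0 ≤ x) (hx1 : x < 1)
    (hB' : ∀ k : ℕ, |(k : ℝ)⁻¹ * ∑ i ∈ range k, a i| ≤ B') :
    (Summable fun n => a n * x ^ n) ∧ (Summable fun n : ℕ => (∑ i ∈ range (n + 1), a i) * x ^ n) ∧
      (1 - x) * ∑' n, a n * x ^ n = (1 - x) ^ 2 * ∑' n : ℕ, (∑ i ∈ range (n + 1), a i) * x ^ n := by
  -- |A_{n+1}| ≤ B'·(n+1): linear growth
  have hlin : ∀ n : ℕ, |∑ i ∈ range (n + 1), a i| ≤ B' * (n + 1) := by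
    intro n
    have hk : (0 : ℝ) < (n : ℝ) + 1 := by positivity
    have h := hB' (n + 1)
    push_cast at h
    rw [abs_mul, abs_inv, abs_of_pos hk] at h
    rwa [inv_mul_le_iff₀ hk, mul_comm] at h
  have hA : Summable fun n : ℕ => (∑ i ∈ range (n + 1), a i) * x ^ n :=
    summable_mul_pow_of_abs_le_linear (a := fun n => ∑ i ∈ range (n + 1), a i) hlin hx0 hx1
  obtain ⟨hs, heq⟩ := tsum_mul_pow_eq_one_sub_mul_tsum_partial hA
  exact ⟨hs, hA, by rw [heq]; ring⟩

/-- **THE ABELIAN INCLUSION (C,1) ⊂ ABEL**: `n⁻¹·Σ_{i<n} a i → m ⟹ (1 − x)·Σ' a n xⁿ → m` as x → 1⁻ — the Abel mean is the positive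
mass-one average `(1 − x)²Σ (n+1)xⁿ·σ_{n+1}` of the Cesàro means. [folklore] (Hardy, Divergent Series Thm 55: Abel summability is implied
by (C,k) for every k) -/
theorem abel_of_cesaro {m : ℝ} (hces : Tendsto (fun n : ℕ => (n : ℝ)⁻¹ * ∑ i ∈ range n, a i) atTop (𝓝 m)) :
    Tendsto (fun x : ℝ => (1 - x) * ∑' n, a n * x ^ n) (𝓝[<] 1) (𝓝 m) := by
  obtain ⟨B', hB'⟩ := exists_abs_le_of_tendsto hces
  have hB'0 : 0 ≤ B' := (abs_nonneg _).trans (hB' 0)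
  -- c n := σ_{n+1} − m is bounded and eventually small
  set c : ℕ → ℝ := fun n => ((n : ℝ) + 1)⁻¹ * (∑ i ∈ range (n + 1), a i) - m with hcdef
  have hcb : ∀ n, |c n| ≤ B' + |m| := by
    intro n
    have h := hB' (n + 1); push_cast at h
    have h1 := abs_sub (((n : ℝ) + 1)⁻¹ * ∑ i ∈ range (n + 1), a i) m
    simp only [hcdef]; linarith
  have hcs : Tendsto c atTop (𝓝 0) := by
    have h1 : Tendsto (fun n : ℕ => ((n + 1 : ℕ) : ℝ)⁻¹ * ∑ i ∈ range (n + 1), a i) atTop (𝓝 m) :=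
      hces.comp (tendsto_add_atTop_nat 1)
    have h2 := h1.sub_const m
    rw [sub_self] at h2
    refine h2.congr fun n => ?_
    simp only [hcdef]; push_cast; ring
  rw [Metric.tendsto_nhds]
  intro ε hε
  obtain ⟨N, hN⟩ := Metric.tendsto_atTop.mp hcs (ε / 2) (by linarith)
  set D : ℝ := (N : ℝ) * N * (B' + |m|) + 1 with hD
  have hD0 : 0 < D := by positivity
  set x₀ : ℝ := max (1 / 2) (1 - ε / (4 * D)) with hx₀
  have hx₀1 : x₀ < 1 := max_lt (by norm_num) (by linarith [show 0 < ε / (4 * D) from by positivity])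
  filter_upwards [Ioo_mem_nhdsLT hx₀1] with x hx
  obtain ⟨hx₀x, hx1⟩ := hx
  have hx0 : 0 ≤ x := le_trans (le_trans (by norm_num) (le_max_left _ _)) hx₀x.le
  have h1x : 0 < 1 - x := sub_pos.mpr hx1
  have h1x1 : 1 - x ≤ 1 := by linarith
  have h1x' : 1 - x ≤ ε / (4 * D) := by have := le_max_right (1 / 2 : ℝ) (1 - ε / (4 * D)); linarith
  obtain ⟨-, hA, heq⟩ := abel_eq_sq_mul_tsum_partial hx0 hx1 hB'
  -- (1 − x)Σ a xⁿ − m = Σ' v n·c n with v n = (1 − x)²(n+1)xⁿ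
  obtain ⟨hws, -⟩ := tsum_succ_mul_pow hx0 hx1
  have hv : ∀ n : ℕ, 0 ≤ (1 - x) ^ 2 * (((n : ℝ) + 1) * x ^ n) := fun n => by positivity
  have hvs : Summable fun n : ℕ => (1 - x) ^ 2 * (((n : ℝ) + 1) * x ^ n) := hws.mul_left _
  have hmass : ∑' n : ℕ, (1 - x) ^ 2 * (((n : ℝ) + 1) * x ^ n) = 1 := by
    rw [tsum_mul_left, one_sub_sq_mul_tsum_succ_mul_pow hx0 hx1]
  have hkey : (1 - x) * ∑' n, a n * x ^ n - m = ∑' n : ℕ, (1 - x) ^ 2 * (((n : ℝ) + 1) * x ^ n) * c n := by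
    have hcm : Summable fun n : ℕ => (1 - x) ^ 2 * (((n : ℝ) + 1) * x ^ n) * m := hvs.mul_right m
    have hterm : ∀ n : ℕ, (1 - x) ^ 2 * (((n : ℝ) + 1) * x ^ n) * c n =
        (1 - x) ^ 2 * ((∑ i ∈ range (n + 1), a i) * x ^ n) - (1 - x) ^ 2 * (((n : ℝ) + 1) * x ^ n) * m := by
      intro n
      have hn : ((n : ℝ) + 1) ≠ 0 := by positivity
      have h1 : ((n : ℝ) + 1) * x ^ n * (((n : ℝ) + 1)⁻¹ * ∑ i ∈ range (n + 1), a i) =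
          (∑ i ∈ range (n + 1), a i) * x ^ n := by field_simp
      calc (1 - x) ^ 2 * (((n : ℝ) + 1) * x ^ n) * c n
          = (1 - x) ^ 2 * (((n : ℝ) + 1) * x ^ n * (((n : ℝ) + 1)⁻¹ * ∑ i ∈ range (n + 1), a i)) -
              (1 - x) ^ 2 * (((n : ℝ) + 1) * x ^ n) * m := by simp only [hcdef]; ring
        _ = _ := by rw [h1]
    rw [tsum_congr hterm, (hA.mul_left _).tsum_sub hcm, tsum_mul_left, tsum_mul_right, hmass, one_mul, heq]
  rw [Real.dist_eq, hkey]
  have hη : ∀ n, N ≤ n → |c n| ≤ ε / 2 := fun n hn => by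
    have := hN n hn; rw [Real.dist_eq, sub_zero] at this; exact this.le
  have hest := weighted_tsum_abs_le hv hvs hcb (by linarith) hη
  rw [hmass, mul_one] at hest
  -- the head: (n+1)xⁿ ≤ N for n < N
  have hhead : ∑ n ∈ range N, (1 - x) ^ 2 * (((n : ℝ) + 1) * x ^ n) * |c n| ≤
      (N : ℝ) * ((1 - x) ^ 2 * N * (B' + |m|)) := by
    have hterm : ∀ n ∈ range N, (1 - x) ^ 2 * (((n : ℝ) + 1) * x ^ n) * |c n| ≤ (1 - x) ^ 2 * N * (B' + |m|) := by
      intro n hn'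
      have hn : (n : ℝ) + 1 ≤ N := by exact_mod_cast Nat.succ_le_of_lt (mem_range.mp hn')
      have hxn : x ^ n ≤ 1 := pow_le_one₀ hx0 hx1.le
      have h1 : ((n : ℝ) + 1) * x ^ n ≤ N := by
        calc ((n : ℝ) + 1) * x ^ n ≤ ((n : ℝ) + 1) * 1 := mul_le_mul_of_nonneg_left hxn (by positivity)
          _ ≤ N := by linarith
      calc (1 - x) ^ 2 * (((n : ℝ) + 1) * x ^ n) * |c n| ≤ (1 - x) ^ 2 * N * (B' + |m|) :=
            mul_le_mul (mul_le_mul_of_nonneg_left h1 (by positivity)) (hcb n) (abs_nonneg _) (by positivity)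
        _ = (1 - x) ^ 2 * N * (B' + |m|) := rfl
    have := sum_le_sum hterm
    rwa [sum_const, card_range, nsmul_eq_mul] at this
  have hhead' : (N : ℝ) * ((1 - x) ^ 2 * N * (B' + |m|)) ≤ ε / 4 := by
    have h2 : (N : ℝ) * N * (B' + |m|) ≤ D := by rw [hD]; linarith
    have hsq : (1 - x) ^ 2 ≤ 1 - x := by nlinarith
    calc (N : ℝ) * ((1 - x) ^ 2 * N * (B' + |m|)) = (1 - x) ^ 2 * ((N : ℝ) * N * (B' + |m|)) := by ring
      _ ≤ ε / (4 * D) * D := mul_le_mul (hsq.trans h1x') h2 (by positivity) (by positivity)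
      _ = ε / 4 := by field_simp
  linarith

/-- Summability for free on the Cesàro side: a sequence whose Cesàro means converge has `|a n| ≤ B·(2n + 1)`-type growth, so `Σ a n xⁿ`
converges absolutely for `0 ≤ x < 1`. [folklore] -/
theorem summable_mul_pow_of_cesaro {m x : ℝ} (hces : Tendsto (fun n : ℕ => (n : ℝ)⁻¹ * ∑ i ∈ range n, a i) atTop (𝓝 m))
    (hx0 : 0 ≤ x) (hx1 : x < 1) : Summable fun n => a n * x ^ n := by
  obtain ⟨B', hB'⟩ := exists_abs_le_of_tendsto hces
  exact (abel_eq_sq_mul_tsum_partial hx0 hx1 hB').1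

end

end Summit.QuantumFields.BalabanUV.Beta.EriceFlowEnclosureAbelMeanSeq
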